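import Mathlib
import Summits.MatrixMultiplication.MatrixMultiplication.Theses.SnSubsetDichotomy
import Summits.MatrixMultiplication.MatrixMultiplication.Theorems.SnSubsetDichotomyThresholdSubsetTriplesStubChainProductCard

/-!
# Line `triality-uniquely-cubing-translate` — skeleton for crux `SnSubsetDichotomy.ThresholdSubsetTriples`
# (stmt-MatrixMultiplication-10882, route-MatrixMultiplication-SnSubsetDichotomy; crux-plan, round 1;
# lead a1-0 2026-08-16: `stub_chainProductCard` discharged by the landed p88812, ONE sorry left = `stub_trialityChainDesign`;
# lead c2-0 2026-08-17: skeleton re-registered unchanged — 1 open stub `stub_trialityChainDesign`, wave none)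

**Idea (card `triality-uniquely-cubing-translate`, ideator 1; triage r1-1: pass, r1-2: pass; both panels:
same lever as `cyclotomic-triality`, "keep ONE triality lever, the two construction programmes differ").**
The crux `X = ThresholdSubsetTriples` (`∀ c > 0 ∀ n₀ ∃ n ≥ n₀ ∃ S T U ⊆ S_n`, TPP,
`(n!)^{3/2}e^{-c√n} < |S||T||U|`) is attacked through the `ℤ/3`-EQUIVARIANT ANSATZ `T = gS`, `U = g²S`,
`g³ = 1`: then (PROVED below, `tpp_iff_uniquelyCubing`, copied from the ideator's kernel-checked
`Cruxes/ThresholdSubsetTriples/SketchIdeator1.lean`) the TPP of `(S, gS, g²S)` is the statement that ONE set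
`W := Q(S)·g = {s s'⁻¹ g}` is UNIQUELY CUBING — `w₁w₂w₃ = 1`, `wᵢ ∈ W` only for `(g,g,g)` — so the crux is
TRANSFERRED (`Transfer`, size M, PROVED in this file: `transfer_holds` — hence not a stub) to the one-set statement
`C⁺ = TrialityThreshold`: `∀ c > 0`, cofinally in `n`, some `g` with `g³ = 1` and `S ⊆ S_n` with
`UniquelyCubing (Q(S)g) g` and `|S| > √(n!)·e^{-c√n}` (cube it: `|S|³ > (n!)^{3/2}e^{-3c√n}`).

`C⁺` is then CUT along the card's structural reading ("uniquely-cubing translated quotient sets need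
MULTI-token, multi-scale itineraries; interface = triality-symmetric chain systems") and the triage
sharpenings (r1-2: `Q(S) ∩ C(g) = 1`, so `S` is a partial transversal of `C(g)`-cosets and the twist must move
`≳ 3n/4` points; r1-1: write `orderOf g = 3`):

* HOST FAMILY = FINE CHAIN PRODUCTS (multi-token itineraries made literal).  Let `lvl : Fin n → Fin k` be a
  level map with fibres of size `≤ 3` and `K_j := {σ : σ fixes every x with lvl x < j}`
  (`K_0 = S_n ⊇ K_1 ⊇ ⋯ ⊇ K_k = 1`, `[K_j : K_{j+1}] ≤ n³`, so `k ≥ n/3` genuine steps).  A CHAIN PRODUCT is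
  `S = R_0 R_1 ⋯ R_{k-1}` with `R_j ⊆ K_j` a PARTIAL LEFT TRANSVERSAL of `K_{j+1}` (two elements of `R_j`
  agreeing on the points of level `≤ j` are equal): every level is a token step (where do the `≤ 3` points
  of level `j` go, given the earlier ones), and all coset fibres at a level are translates of ONE pattern.
  Every SUBGROUP `H ≤ S_n` is a chain product along every chain (`R_j` = a transversal of `H ∩ K_j` mod
  `H ∩ K_{j+1}`), so the family contains every subgroup triality design `(H, H^g, H^{g²})` — in particular the
  Cohn–Umans TRIANGLE (Young, `g` = board rotation; triage r1-1/2: "the only `|G|^{1/2-o(1)}` construction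
  known IS a triality design"), which the Young barrier caps at `(n!)^{3/2}e^{-Ω(n)}` — AND entropy-exact
  NON-subgroup members (`|R_j|² ≥ [K_j:K_{j+1}]` is a free per-level choice, no Stirling loss), among them
  the sub-signature classes of card `interleaved-subsignature-ascent` (fibres of size `1`, star
  transpositions).  PRIMARY SUB-FAMILY (the card's "triality-symmetric chain systems"): `lvl` `g`-INVARIANT,
  i.e. levels = `g`-orbits; then `g` normalises every `K_j`, `(R_0⋯R_{k-1})^g = R_0^g ⋯ R_{k-1}^g` with
  `R_j^g ⊆ K_j` again a partial transversal, and the three sets `S, S^g, S^{g²}` are classes of ONE common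
  chain — the TPP becomes a level-by-level twisted-corner condition on one direction system.  (The stub does
  not impose `g`-invariance: a point chain twisted by `g` is an equally good witness; invariance is where the
  search starts.)
* `stub_chainProductCard` (M, provable now; general group theory, shared infrastructure with
  `interleaved-subsignature-ascent`'s `SubsigCard`): unique factorisation along a subgroup chain —
  `|R_0 R_1 ⋯ R_{k-1}| = ∏ |R_j|` for partial left transversals `R_j ⊆ K_j` of `K_{j+1}`, `K` antitone.
* `stub_trialityChainDesign` (XL, OPEN — the load-bearing bet): for every `c > 0`, cofinally in `n`, a
  fine chain product `S` and `g` with `orderOf g = 3` such that `UniquelyCubing (Q(S)g) g` and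
  `∏ |R_j| > √(n!)·e^{-c√n}`.  This is `C⁺` restricted to the host family: strictly between "threshold
  SUBGROUP triality triples in `S_n`" (sibling route SnThresholdCensus' currency, symmetric form) and `X`;
  its size side is exact bookkeeping (`stub_chainProductCard`), its TPP side is one cubic condition on one
  set assembled level by level (top-level necessity: `(R_0, R_0^g, R_0^{g²})` must itself be TPP as SETS —
  fix lower words, right-translation invariance; level `j` inherits the twisted conditions
  `TPP(R_j, ρR_j^g, ρ'R_j^{g²})`, `ρ, ρ'` in prefix quotient sets), and the search space per level is
  `2^{[K_j:K_{j+1}]} ≤ 2^{n³}` up to the symmetry `C(g) ∩ K_j` — the cube-root reduction of the card made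
  level-local.

The glue `ThresholdSubsetTriples_of` (sorry-free) instantiates `K_j := fixingSubgroup {x | lvl x < j}`,
converts the design's level conditions into the transversal hypotheses of `stub_chainProductCard`, gets
`|S| = ∏|R_j| > √(n!)e^{-c√n}`, `g³ = 1` from `orderOf g = 3` (`pow_orderOf_eq_one`), and applies the
proved transfer.  `ThresholdSubsetTriples_skeleton` is the crux modulo exactly the two registered stubs
`Stub.stub_chainProductCard` (M, provable now) and `Stub.stub_trialityChainDesign` (XL, open, hardest).

**Design rules PROVED here (triage r1-2's sharpening, used by the lead's search, not by the glue):**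
`quot_comm_imp_eq` — under `UniquelyCubing (Q(S)g) g` no non-trivial quotient `s s'⁻¹` commutes with `g`
(`(qg)(q⁻¹g)g = g³ = 1`), hence `footprint_injective` — `s ↦ s⁻¹ g s` is injective on `S`, `S` is a partial
transversal of the right cosets of `C(g)` and `|S| ≤ |g^{S_n}| = n!/(3^k k! f!)` for `g` of type `3^k1^f`:
with `|S| > √(n!)e^{-c√n}` this forces `f ≤ (1/4 + o(1))n` (r1-2: `f/n ≤ .40` at `n = 240`, `.37` at `960`) —
a single 3-cycle allows `|S| ≤ n(n-1)(n-2)/3` only.  Degenerate `g = 1` (r1-1) gives `|S| ≤ 1`: excluded by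
`orderOf g = 3` in the design stub (the transfer itself needs only `g ^ 3 = 1`).

**Disproof used** (`Cruxes/ThresholdSubsetTriples/Disproof.lean`, cdisprove cycle 1 v4 "NO KILL", read at
plan time; no `Negative/` lemma has landed under `Theorems/ThresholdSubsetTriples/`, nothing to import):
`thresholdSubsetTriples_false_without_pos` — every stub keeps `0 < c` (`stub_trialityChainDesign` is
`∀ c > 0`; at `c = 0` it would beat packing, `not_beats_zero`); `thresholdSubsetTriplesWithoutCofinal_holds`
— all statements are cofinal in `n` (`∀ n₀ ∃ n ≥ n₀`), small-`n` data below is orientation only;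
`thresholdSubsetTriplesWithoutTPP_holds` — the TPP is consumed exactly once, as `UniquelyCubing`, a genuinely
THREE-fold condition (§5 `thresholdSubsetTriplesPairwise_holds`: its pairwise shadow `Q(S) ∩ Q(S)^g = 1` is
the free part, = `quot_comm_imp_eq`'s hypothesis class); §4 `thresholdSubsetTriples_iff_balanced` /
`card_window_of_beats` — a triality witness IS balanced (`|S| = |gS| = |g²S|`) and `C⁺` is stated in the
balanced currency `|S| > √(n!)e^{-c√n}`; `thresholdSubsetTriples_iff_rooted` — rooting commutes with the
ansatz (`(Sa, gSa, g²Sa)`), chain products with `1 ∈ R_j ∀ j` are rooted; REFUTED STRENGTHENING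
`not_thresholdYoungTriples` — the design stub is NOT an instance: Young chain products are the subgroup
members the barrier kills (`BCCGU2017_thm42_holds`), the bet is on the entropy-exact non-subgroup members
(for which `Q(S) ⊄` any threshold-size Young subgroup); `ledger negatives` (triage r1-2: 4 items, STPP
line/frame designs and design flattening) — unrelated, no stub is a near-restatement.
-/

namespace Summit.MatrixMultiplication.MatrixMultiplication.Cruxes.ThresholdSubsetTriples.TrialityUniquelyCubingTranslate

open scoped Pointwise BigOperators
open Literature.Combinatorics.Additive
open Summit.MatrixMultiplication.MatrixMultiplication.Theses.SnSubsetDichotomy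
open Summit.MatrixMultiplication.MatrixMultiplication.Theorems.ThresholdSubsetTriples (chainProd)

set_option linter.dupNamespace false

/-! ## Definitions (the line's currency) -/

section Defs

variable {G : Type*} [Group G] [DecidableEq G]

/-- `W` cubes to `1` only as `g · g · g`. -/
def UniquelyCubing (W : Finset G) (g : G) : Prop :=
  ∀ w₁ ∈ W, ∀ w₂ ∈ W, ∀ w₃ ∈ W, w₁ * w₂ * w₃ = 1 → w₁ = g ∧ w₂ = g ∧ w₃ = g

/-- The translated (right) quotient set `W = Q(S)·g = {s · s'⁻¹ · g : s, s' ∈ S}`. -/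
def quotTranslate (S : Finset G) (g : G) : Finset G :=
  (S ×ˢ S).image fun p => p.1 * p.2⁻¹ * g

-- `chainProd R = (List.ofFn R).prod` (the chain product `R 0 · R 1 ⋯ R (k-1)`) is the LANDED definition
-- `Summit.MatrixMultiplication.MatrixMultiplication.Theorems.ThresholdSubsetTriples.chainProd` (p88812), opened below.

end Defs

/-- **`C⁺ = TrialityThreshold`** (the card's Transfer, one-set balanced currency): for every `c > 0`,
cofinally in `n`, an element `g` with `g³ = 1` and ONE set `S ⊆ S_n` whose translated quotient set
`Q(S)·g` is uniquely cubing, of size `|S| > √(n!)·e^{-c√n}`. -/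
def TrialityThreshold : Prop :=
  ∀ c : ℝ, 0 < c → ∀ n₀ : ℕ, ∃ n ≥ n₀, ∃ g : Equiv.Perm (Fin n), g ^ 3 = 1 ∧
    ∃ S : Finset (Equiv.Perm (Fin n)), UniquelyCubing (quotTranslate S g) g ∧
      Real.sqrt (n.factorial : ℝ) * Real.exp (-(c * Real.sqrt (n : ℝ))) < (S.card : ℝ)

/-! ## The transfer statement and the two stub statements -/

/-- **The transfer `C⁺ → crux` (size M; PROVED in this file, `transfer_holds`, so NOT a stub; a worker may
land it verbatim in `Theorems/`).**  Given `c > 0` and `n₀`, apply `C⁺` at `c/3`: `|S| > √(n!)e^{-(c/3)√n}`;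
put `T := gS`, `U := g²S` (`|T| = |U| = |S|`, left multiplication is injective); `TPP(S, gS, g²S)` is
`UniquelyCubing (Q(S)g) g` (`tpp_iff_uniquelyCubing`, needs only `g ^ 3 = 1`); and
`|S|³ > (√(n!)e^{-(c/3)√n})³ = (n!)^{3/2}e^{-c√n}` (`Real.rpow_div_two_eq_sqrt`, `Real.exp_nat_mul`).
[Neumann2011 doi:10.1112/s1461157010000288 Obs. 2.1 (translation equivalence); CohnUmans2003 Def. 2.1;
tree: `TripleProductProperty`; `Cruxes/ThresholdSubsetTriples/SketchIdeator1.lean` (rc 0, 0 sorries)] -/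
def Transfer : Prop :=
  TrialityThreshold → ThresholdSubsetTriples

/-- **Stub 1 — unique factorisation along a subgroup chain (size M, provable now; general group theory,
shared infrastructure with card `interleaved-subsignature-ascent`'s `SubsigCard`, which is the case
`K_j = Stab(n-1, …, n-j)`, `R_j` = star transpositions).**  For an antitone chain of subgroups
`K 0 ≥ K 1 ≥ ⋯ ≥ K k` of any group and finite sets `R j ⊆ K j` (`j < k`) that are PARTIAL LEFT
TRANSVERSALS of `K (j+1)` in `K j` (`r⁻¹ r' ∈ K (j+1)`, `r, r' ∈ R j ⇒ r = r'`), the multiplication map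
`R 0 × ⋯ × R (k-1) → G` is injective, i.e. `|R 0 ⋯ R (k-1)| = ∏ |R j|`.
Proof: induction on `k` (`List.ofFn_succ`): if `r₀ x = r₀' x'` with `x, x' ∈ R 1 ⋯ R (k-1) ⊆ K 1`
(antitone: `R j ⊆ K j ≤ K 1` for `j ≥ 1`, and `K 1` is a subgroup) then `r₀⁻¹ r₀' = x x'⁻¹ ∈ K 1`, so
`r₀ = r₀'`, cancel and recurse on the shifted chain `j ↦ K (j+1)`; cardinality via
`Finset.card_mul_iff`/`Set.InjOn` or `Finset.card_image₂_iff`. [folklore: Sims 1970 / Schreier–Sims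
stabiliser chains; Seress, *Permutation Group Algorithms* (2003) §4.1; Mathlib `Subgroup.IsComplement`] -/
def stub_chainProductCard : Prop :=
  ∀ (G : Type) [Group G] [DecidableEq G] (k : ℕ) (K : Fin (k + 1) → Subgroup G) (R : Fin k → Finset G),
    Antitone K →
    (∀ j : Fin k, ∀ r ∈ R j, r ∈ K j.castSucc) →
    (∀ j : Fin k, ∀ r ∈ R j, ∀ r' ∈ R j, r⁻¹ * r' ∈ K j.succ → r = r') →
    (chainProd R).card = ∏ j, (R j).card

/-- **Stub 2 — TRIALITY CHAIN DESIGNS (size XL, OPEN: the load-bearing bet of the line).**  For every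
`c > 0`, cofinally in `n`, there are `g ∈ S_n` of order `3`, a level map `lvl : Fin n → Fin k` with fibres
of size `≤ 3` (the chain `K_j = {σ : σ x = x ∀ x, lvl x < j}` has steps of index `≤ n³`, hence `≥ n/3`
genuine steps), and level sets `R j ⊆ K_j` that are partial left transversals of `K_{j+1}` (two elements of
`R j` agreeing on all points of level `≤ j` coincide), such that the chain product `S = R 0 ⋯ R (k-1)` has
`Q(S)·g` UNIQUELY CUBING and `∏ |R j| > √(n!)·e^{-c√n}`.  PRIMARY sub-family for the search: `lvl`
`g`-invariant (levels = `g`-orbits), where `g` normalises every `K_j` and `S, S^g, S^{g²}` are classes of ONE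
chain; the stub itself does not impose it (a point chain twisted by `g` is an equally good witness).
WHY IT MIGHT BE TRUE: the family contains every subgroup design `(H, H^g, H^{g²})` (triangle: loss
`e^{-0.33 m²} = e^{-0.65 n}` per set, `n = m(m+1)/2`) and, unlike Young subgroups, entropy-exact members
(`|R j|² ≥ [K_j : K_{j+1}]` is a free choice per level); on a `g`-stable chain the three conjugates are
classes of the SAME chain, so the TPP is a level-by-level twisted-corner condition on one direction system
(card: "triality-symmetric chain systems"), searchable one level at a time with the cube-root reduction; no
theorem in tree / negatives / barriers bounds symmetric or chain-structured triples below threshold (triage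
r1-1/2).
WHY IT MIGHT FAIL: (i) a structured equivariant `¬`: unique cubing may force the level efficiencies
`η_j = |R j|/[K_j:K_{j+1}]^{1/2}` to have `Σ_j log(1/η_j) = Ω(n)` (the triangle's rate), e.g. through the
twisted level conditions — this would kill the LINE, not `X`; (ii) per-point efficiency of every family on the
hub FALLS with `n` so far (triage r1-2: `.744 → .646`, `n = 4..8`; symmetric records `43³` at `n = 8`,
`192·384²`-type hosted hits at `n = 10`), and nothing here is a mechanism forcing `η_j → 1`; (iii) `¬X`
(crux 8302) may simply be true.  CHEAPEST FALSIFIER: exact/beam search over chain products at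
`n = 6, 9, 12` (`g` fixed-point-free, levels = `g`-orbits, one pattern `R j ⊆ K_j` + one translate per
coset, UC tested on ONE set) against the triangle (`12` at `n = 6`) and the symmetric records (`43` at
`n = 8`, `.0041·(10!)^{3/2}` at `n = 10`): KILL the line if the best chain product stays below the best
subgroup design by a factor growing in `n`.
[BlasiakChurchCohnGrochowUmans2017 = arXiv:1712.02302 §4 Thm 4.2, §5 p. 11 (calibration
`n!^{1/2}/e^{O(√n)}` vs `e^{o(√n)}`); CohnUmans2003 §7 (triangle); Neumann2011 Obs. 2.1; KeevashLifshitz2023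
arXiv:2307.15030 / arXiv:2205.15191 (structure of dense product-free sets: junta-like = chain products with
pinned levels); cards `triality-uniquely-cubing-translate`, `interleaved-subsignature-ascent`] -/
def stub_trialityChainDesign : Prop :=
  ∀ c : ℝ, 0 < c → ∀ n₀ : ℕ, ∃ n ≥ n₀, ∃ g : Equiv.Perm (Fin n), orderOf g = 3 ∧
    ∃ k : ℕ, ∃ lvl : Fin n → Fin k,
      (∀ j : Fin k, (Finset.univ.filter fun x => lvl x = j).card ≤ 3) ∧
      ∃ R : Fin k → Finset (Equiv.Perm (Fin n)),
        (∀ j : Fin k, ∀ r ∈ R j, ∀ x : Fin n, lvl x < j → r x = x) ∧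
        (∀ j : Fin k, ∀ r ∈ R j, ∀ r' ∈ R j, (∀ x : Fin n, lvl x ≤ j → r' x = r x) → r = r') ∧
        UniquelyCubing (quotTranslate (chainProd R) g) g ∧
        Real.sqrt (n.factorial : ℝ) * Real.exp (-(c * Real.sqrt (n : ℝ))) <
          ((∏ j, (R j).card : ℕ) : ℝ)

/-! ## Proved here: the triality reduction, the transfer, the design rules -/

section Triality

variable {G : Type*} [Group G] [DecidableEq G]

/-- TRIALITY REDUCTION, six-variable form (ideator 1, `SketchIdeator1.tpp_leftTranslates_iff`, verbatim):
for `g³ = 1`, `(S, gS, g²S)` has the TPP iff `q₁ g q₂ g q₃ g = 1` with `qᵢ ∈ Q(S)` forces `qᵢ = 1`. -/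
theorem tpp_leftTranslates_iff (S : Finset G) (g : G) (hg : g ^ 3 = 1) :
    TripleProductProperty S (S.image (g * ·)) (S.image (g * g * ·)) ↔
      ∀ s₁ ∈ S, ∀ s₁' ∈ S, ∀ s₂ ∈ S, ∀ s₂' ∈ S, ∀ s₃ ∈ S, ∀ s₃' ∈ S,
        s₁ * s₁'⁻¹ * g * (s₂ * s₂'⁻¹) * g * (s₃ * s₃'⁻¹) * g = 1 →
          s₁ = s₁' ∧ s₂ = s₂' ∧ s₃ = s₃' := by
  have hg3 : g * g * g = 1 := by simpa [pow_succ, mul_assoc] using hg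
  constructor
  · intro h s₁ hs₁ s₁' hs₁' s₂ hs₂ s₂' hs₂' s₃ hs₃ s₃' hs₃' heq
    have key := h s₁ hs₁ s₁' hs₁' (g * s₂) (Finset.mem_image_of_mem _ hs₂) (g * s₂')
      (Finset.mem_image_of_mem _ hs₂') (g * g * s₃) (Finset.mem_image_of_mem _ hs₃) (g * g * s₃')
      (Finset.mem_image_of_mem _ hs₃') (by
        calc s₁ * s₁'⁻¹ * (g * s₂ * (g * s₂')⁻¹) * (g * g * s₃ * (g * g * s₃')⁻¹)
            = (s₁ * s₁'⁻¹ * g * (s₂ * s₂'⁻¹) * g * (s₃ * s₃'⁻¹) * g) * (g * g * g)⁻¹ := by group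
          _ = 1 := by rw [heq, hg3]; group)
    exact ⟨key.1, mul_left_cancel key.2.1, mul_left_cancel key.2.2⟩
  · intro h s hs s' hs' t ht t' ht' u hu u' hu' heq
    obtain ⟨s₂, hs₂, rfl⟩ := Finset.mem_image.1 ht
    obtain ⟨s₂', hs₂', rfl⟩ := Finset.mem_image.1 ht'
    obtain ⟨s₃, hs₃, rfl⟩ := Finset.mem_image.1 hu
    obtain ⟨s₃', hs₃', rfl⟩ := Finset.mem_image.1 hu'
    have key := h s hs s' hs' s₂ hs₂ s₂' hs₂' s₃ hs₃ s₃' hs₃' (by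
      calc s * s'⁻¹ * g * (s₂ * s₂'⁻¹) * g * (s₃ * s₃'⁻¹) * g
          = (s * s'⁻¹ * (g * s₂ * (g * s₂')⁻¹) * (g * g * s₃ * (g * g * s₃')⁻¹)) * (g * g * g) := by group
        _ = 1 := by rw [heq, hg3]; group)
    exact ⟨key.1, by rw [key.2.1], by rw [key.2.2]⟩

/-- TRIALITY REDUCTION, one-set form (ideator 1, `SketchIdeator1.tpp_iff_uniquelyCubing`, verbatim):
`TPP(S, gS, g²S) ↔ UniquelyCubing (Q(S)·g) g`. -/
theorem tpp_iff_uniquelyCubing (S : Finset G) (g : G) (hg : g ^ 3 = 1) :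
    TripleProductProperty S (S.image (g * ·)) (S.image (g * g * ·)) ↔
      UniquelyCubing (quotTranslate S g) g := by
  rw [tpp_leftTranslates_iff S g hg]
  unfold UniquelyCubing quotTranslate
  constructor
  · intro h w₁ hw₁ w₂ hw₂ w₃ hw₃ heq
    obtain ⟨⟨s₁, s₁'⟩, hp₁, rfl⟩ := Finset.mem_image.1 hw₁
    obtain ⟨⟨s₂, s₂'⟩, hp₂, rfl⟩ := Finset.mem_image.1 hw₂
    obtain ⟨⟨s₃, s₃'⟩, hp₃, rfl⟩ := Finset.mem_image.1 hw₃
    rw [Finset.mem_product] at hp₁ hp₂ hp₃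
    have key := h s₁ hp₁.1 s₁' hp₁.2 s₂ hp₂.1 s₂' hp₂.2 s₃ hp₃.1 s₃' hp₃.2 (by
      calc s₁ * s₁'⁻¹ * g * (s₂ * s₂'⁻¹) * g * (s₃ * s₃'⁻¹) * g
          = (s₁ * s₁'⁻¹ * g) * (s₂ * s₂'⁻¹ * g) * (s₃ * s₃'⁻¹ * g) := by group
        _ = 1 := heq)
    obtain ⟨h1, h2, h3⟩ := key
    subst h1 h2 h3
    simp
  · intro h s₁ hs₁ s₁' hs₁' s₂ hs₂ s₂' hs₂' s₃ hs₃ s₃' hs₃' heq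
    have hw : ∀ a ∈ S, ∀ b ∈ S, a * b⁻¹ * g ∈ (S ×ˢ S).image (fun p => p.1 * p.2⁻¹ * g) :=
      fun a ha b hb => Finset.mem_image.2 ⟨(a, b), Finset.mem_product.2 ⟨ha, hb⟩, rfl⟩
    have key := h _ (hw s₁ hs₁ s₁' hs₁') _ (hw s₂ hs₂ s₂' hs₂') _ (hw s₃ hs₃ s₃' hs₃') (by
      calc (s₁ * s₁'⁻¹ * g) * (s₂ * s₂'⁻¹ * g) * (s₃ * s₃'⁻¹ * g)
          = s₁ * s₁'⁻¹ * g * (s₂ * s₂'⁻¹) * g * (s₃ * s₃'⁻¹) * g := by group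
        _ = 1 := heq)
    have e : ∀ a b : G, a * b⁻¹ * g = g → a = b := fun a b hab => by
      have h1 : a * b⁻¹ = 1 := mul_right_cancel (hab.trans (one_mul g).symm)
      exact mul_inv_eq_one.1 h1
    exact ⟨e _ _ key.1, e _ _ key.2.1, e _ _ key.2.2⟩

/-- DESIGN RULE 1 (triage r1-2, proved): under unique cubing no non-trivial quotient `s s'⁻¹` commutes
with `g` — because `(q g)(q⁻¹ g) g = g³ = 1` is a cubing triple.  Hence `Q(S) ∩ C(g) = {1}`. -/
theorem quot_comm_imp_eq (S : Finset G) (g : G) (hg : g ^ 3 = 1)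
    (hUC : UniquelyCubing (quotTranslate S g) g) {s s' : G} (hs : s ∈ S) (hs' : s' ∈ S)
    (hcomm : s * s'⁻¹ * g = g * (s * s'⁻¹)) : s = s' := by
  have hg3 : g * g * g = 1 := by simpa [pow_succ, mul_assoc] using hg
  have hw : ∀ a ∈ S, ∀ b ∈ S, a * b⁻¹ * g ∈ quotTranslate S g :=
    fun a ha b hb => Finset.mem_image.2 ⟨(a, b), Finset.mem_product.2 ⟨ha, hb⟩, rfl⟩
  have hprod : (s * s'⁻¹ * g) * (s' * s⁻¹ * g) * (s * s⁻¹ * g) = 1 := by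
    calc (s * s'⁻¹ * g) * (s' * s⁻¹ * g) * (s * s⁻¹ * g)
        = (g * (s * s'⁻¹)) * (s' * s⁻¹ * g) * (s * s⁻¹ * g) := by rw [hcomm]
      _ = g * g * g := by group
      _ = 1 := hg3
  have key := (hUC _ (hw s hs s' hs') _ (hw s' hs' s hs) _ (hw s hs s hs) hprod).1
  have h1 : s * s'⁻¹ = 1 := mul_right_cancel (key.trans (one_mul g).symm)
  exact mul_inv_eq_one.1 h1

/-- DESIGN RULE 2 (triage r1-2, proved): the footprint map `s ↦ s⁻¹ g s` is injective on `S`; so `S` is a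
partial transversal of the right cosets of `C(g)` and `|S| ≤ |g^{S_n}| = n!/(3^k·k!·f!)` for `g` of cycle
type `3^k 1^f` — with `|S| > √(n!)e^{-c√n}` the twist must move `≥ (3/4 - o(1))·n` points. -/
theorem footprint_injective (S : Finset G) (g : G) (hg : g ^ 3 = 1)
    (hUC : UniquelyCubing (quotTranslate S g) g) :
    Set.InjOn (fun s : G => s⁻¹ * g * s) (S : Set G) := by
  intro s hs s' hs' heq
  have hs0 : s ∈ S := by simpa using hs
  have hs0' : s' ∈ S := by simpa using hs'
  refine quot_comm_imp_eq S g hg hUC hs0 hs0' ?_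
  have heq' : s⁻¹ * g * s = s'⁻¹ * g * s' := heq
  calc s * s'⁻¹ * g = s * (s'⁻¹ * g * s') * s'⁻¹ := by group
    _ = s * (s⁻¹ * g * s) * s'⁻¹ := by rw [heq']
    _ = g * (s * s'⁻¹) := by group

/-- DESIGN RULE 2, counted: `|S| ≤ #{h : h conjugate to g}`. -/
theorem card_le_card_conj [Fintype G] (S : Finset G) (g : G) (hg : g ^ 3 = 1)
    (hUC : UniquelyCubing (quotTranslate S g) g) :
    S.card ≤ (Finset.univ.filter fun h : G => IsConj g h).card := by
  refine Finset.card_le_card_of_injOn (fun s : G => s⁻¹ * g * s) (fun s _ => ?_)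
    (footprint_injective S g hg hUC)
  simp only [Finset.coe_filter, Finset.mem_univ, true_and, Set.mem_setOf_eq]
  exact isConj_iff.2 ⟨s⁻¹, by group⟩

end Triality

/-- **The transfer is PROVED**: `C⁺ → X`. -/
theorem transfer_holds : Transfer := by
  intro hC c hc n₀
  obtain ⟨n, hn, g, hg, S, hUC, hbig⟩ := hC (c / 3) (by positivity) n₀
  refine ⟨n, hn, S, S.image (g * ·), S.image (g * g * ·), (tpp_iff_uniquelyCubing S g hg).2 hUC, ?_⟩
  rw [Finset.card_image_of_injective _ (mul_right_injective g),
    Finset.card_image_of_injective _ (mul_right_injective (g * g))]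
  have hF : (0 : ℝ) < (n.factorial : ℝ) := by exact_mod_cast Nat.factorial_pos n
  set F : ℝ := (n.factorial : ℝ) with hFdef
  have h0 : 0 ≤ Real.sqrt F * Real.exp (-(c / 3 * Real.sqrt (n : ℝ))) := by positivity
  have hcube : (Real.sqrt F * Real.exp (-(c / 3 * Real.sqrt (n : ℝ)))) ^ 3 < (S.card : ℝ) ^ 3 :=
    pow_lt_pow_left₀ hbig h0 three_ne_zero
  have h3 : ((3 : ℕ) : ℝ) * -(c / 3 * Real.sqrt (n : ℝ)) = -(c * Real.sqrt (n : ℝ)) := by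
    push_cast
    ring
  have hlhs : (Real.sqrt F * Real.exp (-(c / 3 * Real.sqrt (n : ℝ)))) ^ 3 =
      F ^ ((3 : ℝ) / 2) * Real.exp (-(c * Real.sqrt (n : ℝ))) := by
    rw [mul_pow, Real.rpow_div_two_eq_sqrt _ hF.le, Real.rpow_ofNat, ← Real.exp_nat_mul, h3]
  have hrhs : ((S.card : ℝ)) ^ 3 = ((S.card * S.card * S.card : ℕ) : ℝ) := by
    push_cast
    ring
  rw [← hrhs, ← hlhs]
  exact hcube

/-! ## The glue: crux modulo the two stubs (kernel-checked, no `sorry` below this line outside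
`namespace Stub`) -/

/-- **`ThresholdSubsetTriples_of`** — composition of the line.  From the design (Stub 2) at scale `c`
take `n, g, lvl, R`; the chain `K j := fixingSubgroup {x | lvl x < j}` (`j ≤ k`) is antitone
(`fixingSubgroup_antitone`), `R j ⊆ K j` and the "agree on levels `≤ j` ⇒ equal" hypothesis is exactly
partial transversality of `K (j+1)` (`r⁻¹ r'` fixes `x` iff `r' x = r x`), so Stub 1 gives
`|R 0 ⋯ R (k-1)| = ∏ |R j| > √(n!)e^{-c√n}`; `orderOf g = 3` gives `g ^ 3 = 1`; this is `C⁺` at scale `c`,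
and the proved transfer `transfer_holds` concludes. -/
theorem ThresholdSubsetTriples_of (hC : stub_chainProductCard) (hD : stub_trialityChainDesign) :
    ThresholdSubsetTriples := by
  refine transfer_holds fun c hc n₀ => ?_
  obtain ⟨n, hn, g, hg, k, lvl, -, R, hRK, hRT, hUC, hbig⟩ := hD c hc n₀
  refine ⟨n, hn, g, ?_, chainProd R, hUC, ?_⟩
  · rw [← hg]
    exact pow_orderOf_eq_one g
  · -- the chain of pointwise stabilisers of the low levels
    let K : Fin (k + 1) → Subgroup (Equiv.Perm (Fin n)) := fun j =>
      fixingSubgroup (Equiv.Perm (Fin n)) {x : Fin n | ((lvl x : ℕ) : ℕ) < (j : ℕ)}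
    have hK : Antitone K := by
      intro i j hij
      refine fixingSubgroup_antitone (Equiv.Perm (Fin n)) (Fin n) ?_
      intro x hx
      simp only [Set.mem_setOf_eq] at hx ⊢
      exact lt_of_lt_of_le hx (Fin.le_def.1 hij)
    have hRK' : ∀ j : Fin k, ∀ r ∈ R j, r ∈ K j.castSucc := by
      intro j r hr
      rw [mem_fixingSubgroup_iff]
      intro y hy
      simp only [Set.mem_setOf_eq, Fin.val_castSucc] at hy
      rw [Equiv.Perm.smul_def]
      exact hRK j r hr y (Fin.lt_def.2 hy)
    have hRT' : ∀ j : Fin k, ∀ r ∈ R j, ∀ r' ∈ R j, r⁻¹ * r' ∈ K j.succ → r = r' := by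
      intro j r hr r' hr' hmem
      rw [mem_fixingSubgroup_iff] at hmem
      refine hRT j r hr r' hr' fun x hx => ?_
      have hx' : x ∈ {x : Fin n | ((lvl x : ℕ) : ℕ) < ((j.succ : Fin (k + 1)) : ℕ)} := by
        simp only [Set.mem_setOf_eq, Fin.val_succ]
        exact Nat.lt_succ_of_le (Fin.le_def.1 hx)
      have h1 := hmem x hx'
      rw [Equiv.Perm.smul_def, Equiv.Perm.mul_apply] at h1
      -- `r⁻¹ (r' x) = x` gives `r' x = r x`
      have h2 := congrArg r h1
      simpa using h2
    have hcard : (chainProd R).card = ∏ j, (R j).card := hC (Equiv.Perm (Fin n)) k K R hK hRK' hRT'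
    rw [hcard]
    exact hbig

/-! ## Registered stubs (`sorry` lives only here; signatures = the statements above, verbatim) -/

namespace Stub

/-- Stub 1 (M) — unique factorisation along a subgroup chain: LANDED (p88812), discharged by the tree theorem
`Summit.MatrixMultiplication.MatrixMultiplication.Theorems.ThresholdSubsetTriples.stub_chainProductCard`. -/
theorem stub_chainProductCard : ∀ (G : Type) [Group G] [DecidableEq G] (k : ℕ) (K : Fin (k + 1) → Subgroup G) (R : Fin k → Finset G), Antitone K → (∀ j : Fin k, ∀ r ∈ R j, r ∈ K j.castSucc) → (∀ j : Fin k, ∀ r ∈ R j, ∀ r' ∈ R j, r⁻¹ * r' ∈ K j.succ → r = r') → (chainProd R).card = ∏ j, (R j).card :=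
  Summit.MatrixMultiplication.MatrixMultiplication.Theorems.ThresholdSubsetTriples.stub_chainProductCard

/-- Stub 2 (XL, OPEN, hardest) — triality chain designs at threshold. -/
theorem stub_trialityChainDesign : ∀ c : ℝ, 0 < c → ∀ n₀ : ℕ, ∃ n ≥ n₀, ∃ g : Equiv.Perm (Fin n), orderOf g = 3 ∧ ∃ k : ℕ, ∃ lvl : Fin n → Fin k, (∀ j : Fin k, (Finset.univ.filter fun x => lvl x = j).card ≤ 3) ∧ ∃ R : Fin k → Finset (Equiv.Perm (Fin n)), (∀ j : Fin k, ∀ r ∈ R j, ∀ x : Fin n, lvl x < j → r x = x) ∧ (∀ j : Fin k, ∀ r ∈ R j, ∀ r' ∈ R j, (∀ x : Fin n, lvl x ≤ j → r' x = r x) → r = r') ∧ UniquelyCubing (quotTranslate (chainProd R) g) g ∧ Real.sqrt (n.factorial : ℝ) * Real.exp (-(c * Real.sqrt (n : ℝ))) < ((∏ j, (R j).card : ℕ) : ℝ) := by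
  sorry

end Stub

/-- **The skeleton**: the crux modulo exactly the two registered stubs `Stub.stub_chainProductCard`,
`Stub.stub_trialityChainDesign` (the transfer `transfer_holds` is proved). -/
theorem ThresholdSubsetTriples_skeleton : ThresholdSubsetTriples :=
  ThresholdSubsetTriples_of Stub.stub_chainProductCard Stub.stub_trialityChainDesign

end Summit.MatrixMultiplication.MatrixMultiplication.Cruxes.ThresholdSubsetTriples.TrialityUniquelyCubingTranslate
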